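import Literature.NumberTheory.Sieve.PolynomialCongruencesLemmas
import Literature.NumberTheory.Sieve.PolynomialCongruencesRootCount
import Literature.NumberTheory.LFunctions.MertensTail
import HarnessLib

/-!
# The density input of Hooley's method: `∑_{p ≤ x} √ρ_f(p)/p ≤ (1 − δ_n) log log x + O(1)`

Topic `Literature/NumberTheory/Sieve`, second layer of the decomposition of the named fact
`Literature.NumberTheory.Sieve.hooley_polyRoots_logPowerSaving` (`PolynomialCongruences.lean`; Hooley 1964 as printed in
Dartyge–Martin 2019, Lemma 5).  Everything here is PROVED.

For `f ∈ ℤ[X]` irreducible of degree `n ≥ 2` with root counts `ρ_f(p) = polyRootCountMod ![f] p`,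
Hooley's saving `(log x)^{−δ_n}`, `δ_n = (n − √n)/n!` (`hooleyDelta n`), comes from the prime sum
`∑_{p ≤ x} √ρ_f(p)/p`: the final step of his argument bounds `Σ₁` by
`exp(∑_{p ≤ x} √ρ_f(p)/p)` (Martin–Sitar 2011, §3.2, last display: "`(log x)^{√2}`" for a
reducible quadratic), and for irreducible `f` Hooley's Lemmas 5–6 (the prime ideal theorem for
`ℚ(θ)` and the density `≥ 1/n!` of the primes splitting completely in the splitting field, "[5,
Lemma 6]" in Zehavi 2020, Lemma 3.5) give the exponent `1 − δ_n`.  We prove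

* `sum_sqrt_polyRootCountMod_div_le` — **the density bound**: there is `C = C(f)` with
  `∑_{p ≤ x} √ρ_f(p)/p ≤ (1 − δ_n) log log x + C` for all `x ≥ 2`,

from the pointwise inequality `√r ≤ r − (n − √n)·ν_g(p)/deg g` (`L` the splitting field of `f`,
`g` the minimal polynomial of an integral generator of `L`, valid for all but finitely many `p`:
`ν_g(p) ≥ 1` forces `f` to split into distinct linear factors mod `p`, i.e. `ρ_f(p) = n`, and
`ν_g(p) ≤ deg g = [L:ℚ] ≤ n!`), and inputs already PROVED in the tree:
`Literature.NumberTheory.Sieve.BatemanHorn1962_rootCountSeries_holds` (`∑_p (ρ_f(p) − 1)/p` converges: Dedekind–Kummer and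
`log ζ_K − log ζ` at `1⁺`, `DegreeOnePrimes.lean`), the same for the monic `g`
(`DegreeOnePrimes.exists_tendsto_sum_primesLE_rootCount_sub_one_div`), the explicit Mertens
bounds `log log x − c ≤ ∑_{p ≤ x} 1/p ≤ log log x + 4` (`MertensElementary.lean`, `MertensTail.lean`),
and, from the companion file `PolynomialCongruencesRootCount.lean`, the finiteness of the primes
modulo which `f` and `f'` have a common root (`exists_forall_not_dvd_derivative_eval`) and
`polyRootCountMod_eq_natDegree_of_splits` (split + separable mod `p ∤ lc f` ⇒ `ρ_f(p) = n`).
What this file adds to `PolynomialCongruencesRootCount.lean` (whose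
`exists_loglog_le_sum_inv_primes_rootCount_eq_natDegree` gives the density of the split primes with
an unspecified constant `c > 0`) is the explicit constant `1/n!` that Hooley's exponent requires:
`exists_splittingField_generator` records `deg g ≤ [L:ℚ] = |Gal(f)| ≤ n!`
(`Polynomial.Gal.card_of_separable`, `Polynomial.Gal.galActionHom_injective`).  The passage "root of
`g` mod `p` ⇒ `f` splits mod `p`" (`map_splits_of_dvd_eval_minpoly`) is the substitution argument
of `PrimeDivisorsOfPolynomials.exists_prime_gt_map_int_splits_of_splits` (evaluation at a root of
`minpoly_ℤ θ` modulo `p` kills the kernel of `ℤ[X] → ℤ[θ]`), run for a prescribed prime.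

## References

* C. Hooley, *On the distribution of the roots of polynomial congruences*, Mathematika 11 (1964),
  39–49, Lemmas 5–6 (not held; numbering from Zehavi, arXiv:2003.13100, §3.1, Lemma 3.5
  "[5, Lemma 6]": Mertens-type lower bound for the primes splitting completely in a Galois
  extension). [Hooley1964]
* G. Martin, S. Sitar, Mathematika 57 (2011), 1–29, §3.2 ("his Lemma 4–Lemma 6 … various
  estimates for the function `ρ_f`"). [MartinSitar2011]
* P. T. Bateman, R. A. Horn, Math. Comp. 16 (1962), p. 364 (the series `∑ (ω(p) − 1)/p`).
  [BatemanHornMathComp1962]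
-/

noncomputable section

open Finset Polynomial Filter Topology
open scoped IntermediateField

namespace Literature.NumberTheory.Sieve

/-! ### Lagrange's bound at every prime for a primitive polynomial -/

/-- **Lagrange**: a primitive `f ∈ ℤ[X]` has at most `deg f` roots modulo every prime `p`
(`f mod p ≠ 0` has at most `deg (f mod p) ≤ deg f` roots in the field `ℤ/p`).  (The tree's
`polyRootCountMod_single_le_natDegree` assumes `p ∤ lc(f)`; for the primes dividing the leading
coefficient primitivity still gives `f mod p ≠ 0`.) [folklore] -/
theorem polyRootCountMod_prime_le_natDegree {f : ℤ[X]} (hf : f.IsPrimitive) {p : ℕ}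
    (hp : p.Prime) : polyRootCountMod ![f] p ≤ f.natDegree := by
  classical
  haveI := Fact.mk hp
  rw [polyRootCountMod_single]
  set g : (ZMod p)[X] := f.map (Int.castRingHom (ZMod p)) with hg
  have hg0 : g ≠ 0 := by
    intro h0
    have hC : (C (p : ℤ)) ∣ f := by
      rw [C_dvd_iff_dvd_coeff]
      intro i
      have : g.coeff i = 0 := by rw [h0, coeff_zero]
      rw [hg, coeff_map, eq_intCast, ZMod.intCast_zmod_eq_zero_iff_dvd] at this
      exact this
    have hu := hf (p : ℤ) hC
    rw [Int.isUnit_iff_natAbs_eq, Int.natAbs_natCast] at hu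
    exact hp.one_lt.ne' hu
  calc #((range p).filter fun ν : ℕ => (p : ℤ) ∣ f.eval (ν : ℤ)) ≤ #(g.roots.toFinset) := by
        refine Finset.card_le_card_of_injOn (fun n : ℕ => (n : ZMod p)) ?_ ?_
        · intro n hn
          rw [mem_coe, mem_filter, mem_range] at hn
          simp only [mem_coe, Multiset.mem_toFinset, mem_roots hg0, IsRoot.def]
          rw [hg, ← Int.cast_natCast, eval_intCast_map, eq_intCast,
            ZMod.intCast_zmod_eq_zero_iff_dvd]
          exact hn.2
        · intro m hm n hn hmn
          rw [mem_coe, mem_filter, mem_range] at hm hn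
          have := congrArg ZMod.val hmn
          rwa [ZMod.val_natCast_of_lt hm.1, ZMod.val_natCast_of_lt hn.1] at this
    _ ≤ Multiset.card g.roots := Multiset.toFinset_card_le _
    _ ≤ g.natDegree := card_roots' _
    _ ≤ f.natDegree := natDegree_map_le

/-- For `f` irreducible of positive degree (hence primitive), `ρ_f(p) ≤ deg f` for every prime
`p`. [folklore] -/
theorem polyRootCountMod_prime_le_natDegree_of_irreducible {f : ℤ[X]} (hf : Irreducible f)
    (hdeg : 0 < f.natDegree) {p : ℕ} (hp : p.Prime) : polyRootCountMod ![f] p ≤ f.natDegree :=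
  polyRootCountMod_prime_le_natDegree (hf.isPrimitive hdeg.ne') hp

/-! ### A root of the minimal polynomial of a generator modulo `p` makes `f` split modulo `p` -/

/-- Let `f ≠ 0` split into linear factors in a finite extension `L/ℚ` generated by an element
`θ` integral over `ℤ`.  Then there is an integer `B ≠ 0` such that for every prime
`p ∤ lc(f) · B` for which `minpoly_ℤ θ` has a root modulo `p`, the reduction `f mod p` splits into
linear factors over `𝔽_p` (write the roots of `f` as `r_i(θ)/b_i`; evaluating `X ↦ a` at a root
`a` of `minpoly_ℤ θ mod p` kills `ker(ℤ[X] → ℤ[θ])`, so the factorisation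
`B f(Y) = lc(f) ∏ (b_i Y − r_i(X))` descends to `𝔽_p`).  This is the substitution argument of
`exists_prime_gt_map_int_splits_of_splits` with the prime prescribed. [folklore] -/
theorem map_splits_of_dvd_eval_minpoly {L : Type*} [Field L] [Algebra ℚ L]
    [FiniteDimensional ℚ L] (f : ℤ[X]) (hf0 : f ≠ 0)
    (hsplitK : (f.map (algebraMap ℤ L)).Splits) {θ : L} (hθint : IsIntegral ℤ θ)
    (hθtop : ℚ⟮θ⟯ = ⊤) :
    ∃ B : ℤ, B ≠ 0 ∧ ∀ p : ℕ, p.Prime → ¬ (p : ℤ) ∣ f.leadingCoeff * B →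
      ∀ a : ℤ, (p : ℤ) ∣ (minpoly ℤ θ).eval a → (f.map (Int.castRingHom (ZMod p))).Splits := by
  classical
  haveI : CharZero L := charZero_of_injective_algebraMap (algebraMap ℚ L).injective
  -- write every root `ρ` of `f` in `L` as `r ρ (θ) / b ρ`
  choose b hb0 r hr using exists_int_mul_eq_aeval hθtop
  set fK : L[X] := f.map (algebraMap ℤ L) with hfK
  set B : ℤ := (fK.roots.map b).prod with hB
  have hB0 : B ≠ 0 := by
    refine Multiset.prod_ne_zero fun h0 => ?_
    obtain ⟨ρ, -, hρ⟩ := Multiset.mem_map.mp h0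
    exact hb0 ρ hρ
  have hlc0 : f.leadingCoeff ≠ 0 := leadingCoeff_ne_zero.mpr hf0
  refine ⟨B, hB0, fun p hp hpdvd a hpa => ?_⟩
  haveI := Fact.mk hp
  have hplc : ((f.leadingCoeff : ℤ) : ZMod p) ≠ 0 := fun h =>
    hpdvd (dvd_mul_of_dvd_left ((ZMod.intCast_zmod_eq_zero_iff_dvd _ _).mp h) _)
  have hpB : ((B : ℤ) : ZMod p) ≠ 0 := fun h =>
    hpdvd (dvd_mul_of_dvd_right ((ZMod.intCast_zmod_eq_zero_iff_dvd _ _).mp h) _)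
  -- evaluation at `a` modulo `p` kills the minimal polynomial of `θ`
  let ψ : ℤ[X] →+* ZMod p := eval₂RingHom (Int.castRingHom (ZMod p)) (a : ZMod p)
  have hψ : ψ (minpoly ℤ θ) = 0 := by
    change eval₂ (Int.castRingHom (ZMod p)) (Int.castRingHom (ZMod p) a) (minpoly ℤ θ) = 0
    rw [eval₂_at_apply, eq_intCast, ZMod.intCast_zmod_eq_zero_iff_dvd]
    exact hpa
  -- the identity `B · f(Y) = lc(f) · ∏ (b_ρ Y - r_ρ)` in `ℤ[X][Y]`, after substituting `θ` for `X`
  let Φ : ℤ[X] →+* L := (aeval θ : ℤ[X] →ₐ[ℤ] L).toRingHom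
  have hΦ : ∀ q : ℤ[X], Φ q = aeval θ q := fun q => rfl
  have hΦC : Φ.comp C = algebraMap ℤ L := RingHom.ext_int _ _
  have hψC : ψ.comp C = Int.castRingHom (ZMod p) := RingHom.ext_int _ _
  let P : ℤ[X][X] := Polynomial.C (C B) * f.map C
  let Q : ℤ[X][X] := Polynomial.C (C f.leadingCoeff) *
    (fK.roots.map fun ρ => Polynomial.C (C (b ρ)) * X - Polynomial.C (r ρ)).prod
  have hPQ : P.map Φ = Q.map Φ := by
    have hP : P.map Φ = Polynomial.C (B : L) * fK := by
      simp only [P, Polynomial.map_mul, Polynomial.map_C, Polynomial.map_map, hΦC, hfK]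
      congr 2
      rw [hΦ, aeval_C, eq_intCast]
    have hQ : Q.map Φ = Polynomial.C (algebraMap ℤ L f.leadingCoeff) *
        (fK.roots.map fun ρ => Polynomial.C (b ρ : L) * (X - Polynomial.C ρ)).prod := by
      simp only [Q, Polynomial.map_mul, Polynomial.map_C, Polynomial.map_multiset_prod,
        Multiset.map_map]
      congr 2
      · rw [hΦ, aeval_C]
      · refine Multiset.map_congr rfl fun ρ _ => ?_
        simp only [Function.comp_apply, Polynomial.map_sub, Polynomial.map_mul, Polynomial.map_C,
          map_X]
        rw [hΦ, hΦ, aeval_C, eq_intCast, ← hr ρ, C_mul, mul_sub]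
    have hprodC : (fK.roots.map fun ρ => Polynomial.C (b ρ : L)).prod = Polynomial.C (B : L) := by
      rw [hB, Int.cast_multiset_prod, map_multiset_prod, Multiset.map_map, Multiset.map_map]
      rfl
    have hlcK : algebraMap ℤ L f.leadingCoeff ≠ 0 :=
      (map_ne_zero_iff _ (RingHom.injective_int _)).mpr hlc0
    rw [hP, hQ, Multiset.prod_map_mul, hprodC]
    conv_lhs => rw [Splits.eq_prod_roots hsplitK, leadingCoeff_map_of_leadingCoeff_ne_zero _ hlcK]
    ring
  have hPQψ : P.map ψ = Q.map ψ := map_eq_map_of_map_aeval_eq hθint ψ hψ hPQ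
  -- the right-hand side is a product of linear factors over `𝔽_p`
  have hQs : (Q.map ψ).Splits := by
    simp only [Q, Polynomial.map_mul, Polynomial.map_C, Polynomial.map_multiset_prod,
      Multiset.map_map]
    refine (Splits.C _).mul (Splits.multisetProd fun F hF => ?_)
    obtain ⟨ρ, -, rfl⟩ := Multiset.mem_map.mp hF
    simp only [Function.comp_apply, Polynomial.map_sub, Polynomial.map_mul, Polynomial.map_C,
      map_X]
    refine Splits.of_degree_le_one ?_
    rw [sub_eq_add_neg, ← C_neg]
    exact degree_linear_le
  have hPψ : P.map ψ = Polynomial.C ((B : ℤ) : ZMod p) * f.map (Int.castRingHom (ZMod p)) := by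
    simp only [P, Polynomial.map_mul, Polynomial.map_C, Polynomial.map_map, hψC]
    congr 2
    change eval₂ _ _ (C B) = _
    rw [eval₂_C, eq_intCast]
  have hfp : f.map (Int.castRingHom (ZMod p)) ≠ 0 := fun h => by
    have := congrArg (fun q => q.coeff f.natDegree) h
    simp only [coeff_map, coeff_natDegree, eq_intCast, coeff_zero] at this
    exact hplc this
  have hne : P.map ψ ≠ 0 := by
    rw [hPψ]; exact mul_ne_zero (C_ne_zero.mpr hpB) hfp
  refine Splits.of_dvd (g := P.map ψ) (by rw [hPQψ]; exact hQs) hne ?_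
  rw [hPψ]
  exact dvd_mul_left _ _

/-! ### The generator polynomial of the splitting field -/

/-- For `f ∈ ℤ[X]` irreducible of degree `n ≥ 1` there is a monic irreducible `g ∈ ℤ[X]` — the
minimal polynomial of an integral generator `θ` of the splitting field `L` of `f` over `ℚ` — with
`deg g ≤ [L:ℚ] ≤ n!` (`Gal(L/ℚ) ↪ 𝔖(roots)`), and an integer `B ≠ 0` such that for every prime
`p ∤ lc(f) · B`, if `g` has a root modulo `p` then `f mod p` splits into linear factors.
[folklore] -/
theorem exists_splittingField_generator {f : ℤ[X]} (hf : Irreducible f) (hdeg : 0 < f.natDegree) :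
    ∃ g : ℤ[X], g.Monic ∧ Irreducible g ∧ g.natDegree ≤ f.natDegree.factorial ∧
      ∃ B : ℤ, B ≠ 0 ∧ ∀ p : ℕ, p.Prime → ¬ (p : ℤ) ∣ f.leadingCoeff * B →
        0 < polyRootCountMod ![g] p → (f.map (Int.castRingHom (ZMod p))).Splits := by
  classical
  have hf0 : f ≠ 0 := hf.ne_zero
  set fQ : ℚ[X] := f.map (algebraMap ℤ ℚ) with hfQ
  have hirrQ : Irreducible fQ :=
    (IsPrimitive.irreducible_iff_irreducible_map_fraction_map (hf.isPrimitive hdeg.ne')).1 hf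
  have hsepQ : fQ.Separable := hirrQ.separable
  let L := fQ.SplittingField
  haveI : CharZero L := charZero_of_injective_algebraMap (algebraMap ℚ L).injective
  haveI : Fact ((fQ.map (algebraMap ℚ L)).Splits) := ⟨SplittingField.splits _⟩
  have hsplitL : (f.map (algebraMap ℤ L)).Splits := by
    have h : ((f.map (algebraMap ℤ ℚ)).map (algebraMap ℚ L)).Splits := SplittingField.splits _
    rw [Polynomial.map_map] at h
    convert h using 3
    exact RingHom.ext_int _ _
  -- an integral primitive element `θ`
  obtain ⟨α, hα⟩ := Field.exists_primitive_element ℚ L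
  obtain ⟨y, hy0, hθint⟩ :=
    ((IsFractionRing.isAlgebraic_iff ℤ ℚ L).mpr (Algebra.IsAlgebraic.isAlgebraic (R := ℚ) α)
      ).exists_integral_multiple
  set θ : L := y • α with hθdef
  have hθtop : ℚ⟮θ⟯ = ⊤ := by
    rw [eq_top_iff, ← hα, IntermediateField.adjoin_simple_le_iff]
    have hy : (y : L) ≠ 0 := by exact_mod_cast hy0
    have : α = (y : L)⁻¹ * θ := by
      rw [hθdef, zsmul_eq_mul, ← mul_assoc, inv_mul_cancel₀ hy, one_mul]
    rw [this]
    exact mul_mem (inv_mem (intCast_mem _ y)) (IntermediateField.mem_adjoin_simple_self ℚ θ)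
  set g := minpoly ℤ θ with hg
  have hgmon : g.Monic := minpoly.monic hθint
  have hgirr : Irreducible g := minpoly.irreducible hθint
  -- `deg g ≤ [L : ℚ] ≤ n!`
  have hθintQ : IsIntegral ℚ θ := hθint.tower_top
  have hdegg : g.natDegree ≤ f.natDegree.factorial := by
    have h1 : g.natDegree = (minpoly ℚ θ).natDegree := by
      rw [minpoly.isIntegrallyClosed_eq_field_fractions' ℚ hθint, hgmon.natDegree_map]
    have h2 : (minpoly ℚ θ).natDegree ≤ Module.finrank ℚ L := minpoly.natDegree_le θ
    have h3 : Module.finrank ℚ L = Nat.card fQ.Gal := (Gal.card_of_separable hsepQ).symm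
    have h4 : Nat.card fQ.Gal ≤ Nat.card (Equiv.Perm (fQ.rootSet L)) :=
      Nat.card_le_card_of_injective _ (Gal.galActionHom_injective fQ L)
    have h5 : Nat.card (Equiv.Perm (fQ.rootSet L)) = (Nat.card (fQ.rootSet L)).factorial := by
      rw [Nat.card_eq_fintype_card, Fintype.card_perm, Nat.card_eq_fintype_card]
    have h6 : Nat.card (fQ.rootSet L) ≤ f.natDegree := by
      rw [Nat.card_coe_set_eq]
      refine (ncard_rootSet_le fQ L).trans ?_
      rw [hfQ, natDegree_map_eq_of_injective (RingHom.injective_int _)]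
    calc g.natDegree ≤ Nat.card fQ.Gal := by rw [h1, ← h3]; exact h2
      _ ≤ (Nat.card (fQ.rootSet L)).factorial := by rw [← h5]; exact h4
      _ ≤ f.natDegree.factorial := Nat.factorial_le h6
  obtain ⟨B, hB0, hB⟩ := map_splits_of_dvd_eval_minpoly f hf0 hsplitL hθint hθtop
  refine ⟨g, hgmon, hgirr, hdegg, B, hB0, fun p hp hpB hpos => ?_⟩
  rw [polyRootCountMod_single, card_pos] at hpos
  obtain ⟨ν, hν⟩ := hpos
  rw [mem_filter] at hν
  exact hB p hp hpB ν hν.2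

/-! ### The density bound -/

/-- The partial sums `∑_{p ≤ x} (ρ_f(p) − 1)/p` are bounded above, for any irreducible `f` of
positive degree (Bateman–Horn 1962, p. 364, via the tree's `BatemanHorn1962_rootCountSeries_holds`,
applied to `±f`). [cite: BatemanHornMathComp1962, p. 364] -/
theorem exists_sum_polyRootCountMod_sub_one_div_le {f : ℤ[X]} (hf : Irreducible f)
    (hdeg : 0 < f.natDegree) :
    ∃ M : ℝ, ∀ x : ℕ, ∑ p ∈ Nat.primesLE x, ((polyRootCountMod ![f] p : ℝ) - 1) / p ≤ M := by
  -- normalise the sign of the leading coefficient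
  obtain ⟨f₁, hf₁, hdeg₁, hlc₁, hρ⟩ : ∃ f₁ : ℤ[X], Irreducible f₁ ∧ 0 < f₁.natDegree ∧
      0 < f₁.leadingCoeff ∧ ∀ p, polyRootCountMod ![f₁] p = polyRootCountMod ![f] p := by
    rcases lt_or_gt_of_ne (leadingCoeff_ne_zero.2 hf.ne_zero) with h | h
    · refine ⟨-f, ?_, by rwa [natDegree_neg], by rw [leadingCoeff_neg]; linarith,
        polyRootCountMod_neg f⟩
      rw [neg_eq_neg_one_mul]
      exact (irreducible_isUnit_mul isUnit_one.neg).2 hf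
    · exact ⟨f, hf, hdeg, h, fun _ => rfl⟩
  obtain ⟨A, hA⟩ := BatemanHorn1962_rootCountSeries_holds f₁ hf₁ hdeg₁ hlc₁
  obtain ⟨M, hM⟩ := hA.bddAbove_range
  refine ⟨M, fun x => ?_⟩
  have := hM ⟨x, rfl⟩
  simpa [hρ] using this

/-- The partial sums `∑_{p ≤ x} (ν_g(p) − 1)/p` are bounded below, for `g` monic irreducible
(`DegreeOnePrimes.exists_tendsto_sum_primesLE_rootCount_sub_one_div`). [folklore] -/
theorem exists_le_sum_polyRootCountMod_sub_one_div {g : ℤ[X]} (hg : g.Monic)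
    (hirr : Irreducible g) :
    ∃ M : ℝ, ∀ x : ℕ, M ≤ ∑ p ∈ Nat.primesLE x, ((polyRootCountMod ![g] p : ℝ) - 1) / p := by
  obtain ⟨A, hA⟩ := LFunctions.DegreeOnePrimes.exists_tendsto_sum_primesLE_rootCount_sub_one_div hg hirr
  obtain ⟨M, hM⟩ := hA.bddBelow_range
  refine ⟨M, fun x => ?_⟩
  have := hM ⟨x, rfl⟩
  simpa [polyRootCountMod_single] using this

/-- `√r ≤ r` for natural numbers `r`. [folklore] -/
theorem sqrt_natCast_le_self (r : ℕ) : Real.sqrt r ≤ r := by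
  rcases Nat.eq_zero_or_pos r with rfl | hr
  · simp
  · have h1 : (1 : ℝ) ≤ r := by exact_mod_cast hr
    rw [Real.sqrt_le_left (by linarith)]
    nlinarith

/-- **The density input of Hooley's method** (Hooley 1964, Lemmas 5–6 in the form used at the end
of his estimation of `Σ₁`; Zehavi 2020, §3.2).  Let `f ∈ ℤ[X]` be irreducible of degree
`n ≥ 2`.  Then there is `C = C(f)` such that for all `x ≥ 2`,
`∑_{p ≤ x} √ρ_f(p) / p ≤ (1 − δ_n) log log x + C`, `δ_n = (n − √n)/n!` (`hooleyDelta n`).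
Proof: `√ρ_f(p) ≤ ρ_f(p) − (n − √n) ν_g(p)/deg g` for all primes not dividing a fixed non-zero
integer (`exists_splittingField_generator`, `polyRootCountMod_eq_natDegree_of_splits`), then sum
with `∑_{p ≤ x} ρ_f(p)/p ≤ log log x + O(1)` and `∑_{p ≤ x} ν_g(p)/p ≥ log log x − O(1)`.
[folklore] -/
theorem sum_sqrt_polyRootCountMod_div_le {f : ℤ[X]} (hf : Irreducible f)
    (hn : 2 ≤ f.natDegree) :
    ∃ C : ℝ, ∀ x : ℕ, 2 ≤ x →
      ∑ p ∈ Nat.primesLE x, Real.sqrt (polyRootCountMod ![f] p) / p ≤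
        (1 - hooleyDelta f.natDegree) * Real.log (Real.log x) + C := by
  have hdeg : 0 < f.natDegree := by omega
  set n := f.natDegree with hndef
  -- the data
  obtain ⟨R, hR0, hRsep⟩ := exists_forall_not_dvd_derivative_eval hf hdeg
  obtain ⟨g, hgmon, hgirr, hdegg, B, hB0, hsplit⟩ := exists_splittingField_generator hf hdeg
  obtain ⟨M₁, hM₁⟩ := exists_sum_polyRootCountMod_sub_one_div_le hf hdeg
  obtain ⟨M₂, hM₂⟩ := exists_le_sum_polyRootCountMod_sub_one_div hgmon hgirr
  set N := g.natDegree with hNdef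
  have hN : 0 < N := by
    rcases Nat.eq_zero_or_pos N with h | h
    · exact absurd ((Polynomial.Monic.natDegree_eq_zero hgmon).1 h ▸ isUnit_one)
        hgirr.1
    · exact h
  set m : ℤ := f.leadingCoeff * B * R with hm
  have hm0 : m ≠ 0 := mul_ne_zero (mul_ne_zero (leadingCoeff_ne_zero.2 hf.ne_zero) hB0) hR0
  -- abbreviations
  set ρ : ℕ → ℝ := fun p => (polyRootCountMod ![f] p : ℝ) with hρ
  set νg : ℕ → ℝ := fun p => (polyRootCountMod ![g] p : ℝ) with hνg
  set c : ℝ := ((n : ℝ) - Real.sqrt n) / N with hc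
  have hn1 : (1 : ℝ) ≤ n := by exact_mod_cast hdeg
  have hsqrt_n : Real.sqrt n ≤ n := sqrt_natCast_le_self n
  have hc0 : 0 ≤ c := div_nonneg (by linarith) (Nat.cast_nonneg _)
  have hN' : (0 : ℝ) < N := by exact_mod_cast hN
  -- pointwise bounds at every prime
  have hρle : ∀ p : ℕ, p.Prime → ρ p ≤ n := fun p hp => by
    simp only [hρ]; exact_mod_cast polyRootCountMod_prime_le_natDegree_of_irreducible hf hdeg hp
  have hνle : ∀ p : ℕ, p.Prime → νg p ≤ N := fun p hp => by
    simp only [hνg]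
    exact_mod_cast polyRootCountMod_prime_le_natDegree hgmon.isPrimitive hp
  have hρ0 : ∀ p, 0 ≤ ρ p := fun p => Nat.cast_nonneg _
  have hν0 : ∀ p, 0 ≤ νg p := fun p => Nat.cast_nonneg _
  -- the key pointwise inequality at the good primes
  have hgood : ∀ p : ℕ, p.Prime → ¬ (p : ℤ) ∣ m →
      Real.sqrt (ρ p) ≤ ρ p - c * νg p := by
    intro p hp hpm
    rcases Nat.eq_zero_or_pos (polyRootCountMod ![g] p) with h0 | hpos
    · have : νg p = 0 := by simp [hνg, h0]
      rw [this, mul_zero, sub_zero]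
      exact sqrt_natCast_le_self _
    · have hlc : ¬ (p : ℤ) ∣ f.leadingCoeff := fun h =>
        hpm (dvd_mul_of_dvd_left (dvd_mul_of_dvd_left h _) _)
      have hpR : ¬ (p : ℤ) ∣ R := fun h => hpm (dvd_mul_of_dvd_right h _)
      have hpB : ¬ (p : ℤ) ∣ f.leadingCoeff * B := fun h => hpm (dvd_mul_of_dvd_left h _)
      have hρn : ρ p = n := by
        simp only [hρ]
        exact_mod_cast polyRootCountMod_eq_natDegree_of_splits hp hlc (hRsep p hpR)
          (hsplit p hp hpB hpos)
      rw [hρn]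
      have : c * νg p ≤ (n : ℝ) - Real.sqrt n := by
        calc c * νg p ≤ c * N := mul_le_mul_of_nonneg_left (hνle p hp) hc0
          _ = (n : ℝ) - Real.sqrt n := by rw [hc]; field_simp
      linarith
  -- hence, at every prime, with an error supported on the finitely many bad primes
  set K : ℝ := (n : ℝ) + c * N with hK
  have hall : ∀ p : ℕ, p.Prime →
      Real.sqrt (ρ p) / p ≤ ρ p / p - c * (νg p / p) +
        (if (p : ℤ) ∣ m then K else 0) := by
    intro p hp
    have hp0 : (0 : ℝ) < p := by exact_mod_cast hp.pos
    split_ifs with hpm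
    · have h1 : Real.sqrt (ρ p) / p ≤ n := by
        rw [div_le_iff₀ hp0]
        have hp1 : (1 : ℝ) ≤ p := by exact_mod_cast hp.one_lt.le
        calc Real.sqrt (ρ p) ≤ ρ p := sqrt_natCast_le_self _
          _ ≤ n := hρle p hp
          _ ≤ n * p := le_mul_of_one_le_right (by linarith) hp1
      have h2 : 0 ≤ ρ p / p := div_nonneg (hρ0 p) hp0.le
      have h3 : c * (νg p / p) ≤ c * N := by
        refine mul_le_mul_of_nonneg_left ?_ hc0
        calc νg p / p ≤ νg p := div_le_self (hν0 p) (by exact_mod_cast hp.one_lt.le)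
          _ ≤ N := hνle p hp
      rw [hK]; linarith
    · have := hgood p hp hpm
      rw [add_zero, mul_div_assoc', ← sub_div]
      exact div_le_div_of_nonneg_right this hp0.le
  -- Mertens' bounds from the tree
  have hmert_up : ∀ x : ℕ, 2 ≤ x →
      ∑ p ∈ Nat.primesLE x, (1 : ℝ) / p ≤ Real.log (Real.log x) + 4 :=
    fun x hx => LFunctions.MertensBound.sum_inv_prime_le x hx
  have hmert_low : ∀ x : ℕ, 2 ≤ x →
      Real.log (Real.log x) - Real.log (Real.log 2) - 6 / Real.log 2 ≤
        ∑ p ∈ Nat.primesLE x, (1 : ℝ) / p := by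
    intro x hx
    have h := LFunctions.MertensBound.loglog_sub_loglog_le_sum_inv_prime (P := 2) (Q := x) le_rfl
      (by exact_mod_cast hx)
    refine h.trans (Finset.sum_le_sum_of_subset_of_nonneg ?_ fun p _ _ => by positivity)
    intro p hp
    simp only [Finset.mem_filter, Finset.mem_Ioc, Nat.floor_natCast] at hp
    exact Nat.mem_primesLE.2 ⟨hp.1.2, hp.2⟩
  -- the bad primes contribute a bounded amount
  have hbad : ∀ x : ℕ, ∑ p ∈ Nat.primesLE x, (if (p : ℤ) ∣ m then K else 0) ≤
      K * m.natAbs := by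
    intro x
    have hK0 : 0 ≤ K := by rw [hK]; positivity
    rw [← Finset.sum_filter]
    calc ∑ p ∈ (Nat.primesLE x).filter (fun p : ℕ => (p : ℤ) ∣ m), K
        = K * #((Nat.primesLE x).filter (fun p : ℕ => (p : ℤ) ∣ m)) := by
          rw [sum_const, nsmul_eq_mul, mul_comm]
      _ ≤ K * #(Finset.Icc 1 m.natAbs) := by
          refine mul_le_mul_of_nonneg_left ?_ hK0
          refine Nat.cast_le.2 (Finset.card_le_card fun p hp => ?_)
          simp only [Finset.mem_filter, Nat.mem_primesLE] at hp
          rw [Finset.mem_Icc]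
          exact ⟨hp.1.2.pos, Nat.le_of_dvd (Int.natAbs_pos.2 hm0) (Int.natCast_dvd.1 hp.2)⟩
      _ = K * m.natAbs := by simp
  -- `c ≥ δ_n`
  have hcδ : hooleyDelta n ≤ c := by
    rw [hooleyDelta_def, hc]
    refine div_le_div_of_nonneg_left (by linarith) hN' ?_
    exact_mod_cast hdegg
  -- assemble
  set C' : ℝ := -M₂ + Real.log (Real.log 2) + 6 / Real.log 2 with hC'
  refine ⟨M₁ + 4 + c * max C' 0 + K * m.natAbs, fun x hx => ?_⟩
  have h1 : ∑ p ∈ Nat.primesLE x, Real.sqrt (ρ p) / p ≤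
      ∑ p ∈ Nat.primesLE x, (ρ p / p - c * (νg p / p) + (if (p : ℤ) ∣ m then K else 0)) :=
    Finset.sum_le_sum fun p hp => hall p (Nat.prime_of_mem_primesLE hp)
  rw [Finset.sum_add_distrib, Finset.sum_sub_distrib, ← Finset.mul_sum] at h1
  have h2 : ∑ p ∈ Nat.primesLE x, ρ p / p ≤ Real.log (Real.log x) + 4 + M₁ := by
    have := hM₁ x
    have h' : ∑ p ∈ Nat.primesLE x, ρ p / p =
        ∑ p ∈ Nat.primesLE x, (ρ p - 1) / p + ∑ p ∈ Nat.primesLE x, (1 : ℝ) / p := by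
      rw [← Finset.sum_add_distrib]
      refine Finset.sum_congr rfl fun p hp => ?_
      have hp0 : (p : ℝ) ≠ 0 := by exact_mod_cast (Nat.prime_of_mem_primesLE hp).ne_zero
      field_simp; ring
    rw [h']
    linarith [hmert_up x hx]
  have h3 : Real.log (Real.log x) - C' ≤ ∑ p ∈ Nat.primesLE x, νg p / p := by
    have := hM₂ x
    have h' : ∑ p ∈ Nat.primesLE x, νg p / p =
        ∑ p ∈ Nat.primesLE x, (νg p - 1) / p + ∑ p ∈ Nat.primesLE x, (1 : ℝ) / p := by
      rw [← Finset.sum_add_distrib]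
      refine Finset.sum_congr rfl fun p hp => ?_
      have hp0 : (p : ℝ) ≠ 0 := by exact_mod_cast (Nat.prime_of_mem_primesLE hp).ne_zero
      field_simp; ring
    rw [h', hC']
    linarith [hmert_low x hx]
  have h4 := hbad x
  have hsum0 : 0 ≤ ∑ p ∈ Nat.primesLE x, νg p / p :=
    Finset.sum_nonneg fun p _ => div_nonneg (hν0 p) (Nat.cast_nonneg _)
  have hδ0 : 0 ≤ hooleyDelta n := (hooleyDelta_pos hn).le
  have hcmax : c * C' ≤ c * max C' 0 := mul_le_mul_of_nonneg_left (le_max_left _ _) hc0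
  have hcmax0 : 0 ≤ c * max C' 0 := mul_nonneg hc0 (le_max_right _ _)
  rcases le_or_gt 0 (Real.log (Real.log x)) with hΛ | hΛ
  · have e1 : c * (Real.log (Real.log x) - C') ≤ c * ∑ p ∈ Nat.primesLE x, νg p / p :=
      mul_le_mul_of_nonneg_left h3 hc0
    have e2 : hooleyDelta n * Real.log (Real.log x) ≤ c * Real.log (Real.log x) :=
      mul_le_mul_of_nonneg_right hcδ hΛ
    nlinarith [h1, h2, h4, e1, e2, hcmax]
  · have e3 : 0 ≤ c * ∑ p ∈ Nat.primesLE x, νg p / p := mul_nonneg hc0 hsum0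
    have e4 : hooleyDelta n * Real.log (Real.log x) ≤ 0 :=
      mul_nonpos_of_nonneg_of_nonpos hδ0 hΛ.le
    nlinarith [h1, h2, h4, e3, e4, hcmax0]

end Literature.NumberTheory.Sieve
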